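/-
Copyright (c) 2026 the pub-hodgecm-mathlib formalisation cell (harness21).  R90-TF SLAB, section S10 (Rogawski 1990, §13.6–13.8 read at `v`), ROW 6 — the (P-t₀) pin payer in the
`hadm`-FORM OF RECORD (RULING (R15) J-hbc-adm, dealer R90-C138-plan (g4) 2026-09-05T03:33:34Z, DEAL #83); prover K2Liu-p13 (g5).  h413 = `stmt-HodgeConjecture-24833`, route
`HCCMUnconditional`.  THEOREMS ONLY (no `def`, no `instance`, no notation, no named-fact hypothesis, no `sorry`); ★-only imports (L9).
-/
import Summits.HodgeConjecture.HodgeConjecture.Theorems.R90S10GermOfMembersOfBC          -- ★ p864664 (this seat): the three (P-t₀) payers with the `hadm`-free `hbc`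
import Summits.HodgeConjecture.HodgeConjecture.Theorems.R90S10LiesOverOfContributing     -- ★ (J1)(J2) (p07): `isAdmissible_of_isLinked`, `germOfDiscreteClass_eq_evpAtIntegralLevel_of_isLinked`
import HarnessLib

/-!
# R90-TF ∕ S10 — ROW 6, THE (P-t₀) PIN PAID MODULO SPHERICAL BASE CHANGE, `hadm`-FORM: `germOfMembersLetter_of_bcSpherical_adm`
# (`Theorems/R90S10GermOfMembersOfBCAdm.lean`; ns `Summit.HodgeConjecture.HodgeConjecture.R90.S10`; lane `--supports stmt-HodgeConjecture-24833`)

RULING (R15) J-hbc-adm (dealer (g4) 03:33:34Z, p02 (g2)'s junction finding UPHELD): both ★ rigidity payers of the BC-spherical input bind ADMISSIBILITY of the class —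
inert ★ p864959 `unopClassSphericalCharacter_eq_of_liesOver_of_heckeFLAt … (hadm : πw.IsAdmissible) (hadm₀ …)`, split ★ p864906
`eq_and_unopClassSphericalCharacter_eq_of_liesOver_frozen_of_split … (hadm) (hadm₀) …` — and «irreducible smooth ⇒ admissible» is not ★; the only consumer of `hbc` (★ p864664
`germOfMembersLetter_of_bcSpherical`) applies it at the members' local classes, which ARE admissible (★ `isAdmissible_of_isLinked`: the local factors of a discrete automorphic
representation).  Hence the `hbc` binder OF RECORD is the **`hadm`-form**: `(hadm : πw.IsAdmissible)` inserted IMMEDIATELY AFTER `(πw : IrrClass (Gqs L w.1))`, everything else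
byte-identical to ★ p864664.

WHAT THIS FILE PROVES — ★ p864664's three statements :81 ∕ :107 ∕ :120 with the `hadm`-form `hbc`, proofs verbatim with the admissibility fed by ★ `isAdmissible_of_isLinked`:
* `germOfMembersLetter_of_bcSpherical_adm (𝔣') (S) (hv) {P} (hRepGerm) (t₀) (hbc)` — generic level `S ∋ v`, pinned subtype `{t // P t}`;
* `germOfMembersLetter_of_bcSpherical_singleton_adm` — `S := {v}`;
* `germOfMembersLetter_of_bcSpherical_plain_adm` — plain germ currency `evp := germOfDiscreteClass S`, `t₀` a bare package (p07 (g2)'s keystone `ht₀`).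
HONEST LABEL: ROW-6 glue; pays the keystone's `ht₀` ONLY MODULO the by-value `hbc` (hadm-form; suppliers: ★ p864959 (inert, modulo (E1-c) `hFLw`) and ★ p864906 (split) through
p08 (g2)'s #84 assembler `hbc_of_hex`); closes no socket by itself; HC_CM is proved only modulo the 7 printed citations (2 remaining named inputs: hLiu418 =
`stmt-HodgeConjecture-24832`, h413 = `stmt-HodgeConjecture-24833`) until rung 0 closes; REL ≠ ★ ≠ BUILT; count-neutral.

## References
* [Rogawski1990] J. D. Rogawski, *Automorphic Representations of Unitary Groups in Three Variables*, Ann. of Math. Stud. 123 (1990): §13.6 p. 209; §13.8 display (13.8.3)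
  p. 218 L5–7, p. 219 L3; §4.9 Prop. 4.9.1 (b) p. 55.
* [FlathCorvallis1979] D. Flath, *Decomposition of representations into tensor products*, Proc. Sympos. Pure Math. 33.1 (1979), Thm. 3.
* [BorelJacquet1979] A. Borel, H. Jacquet, *Automorphic forms and automorphic representations*, Proc. Sympos. Pure Math. 33.1 (1979), §4.6.
* [CartierCorvallis1979] P. Cartier, *Representations of p-adic groups: a survey*, Proc. Sympos. Pure Math. 33 (1979), Part 1, §IV.1 Cor. 4.1.
-/

set_option autoImplicit false
set_option linter.dupNamespace false

noncomputable section

open scoped RestrictedProduct Matrix MatrixGroups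
open Filter MeasureTheory NumberField IsDedekindDomain CompactlySupported
open Literature.NumberTheory.Rogawski1990 Literature.NumberTheory.Automorphic Literature.NumberTheory.Automorphic.UnitaryGroup
open Literature.NumberTheory.Automorphic.UnitaryGroup.CotangentForms Literature.NumberTheory.GaloisRepresentations
open Literature.NumberTheory.Automorphic.Arthur2013.Leaves.TECR
open Summit.HodgeConjecture.HodgeConjecture.Cruxes.H413
open Summit.HodgeConjecture.HodgeConjecture.Cruxes.H413.K2E1TraceFormulaBeta
open Summit.HodgeConjecture.HodgeConjecture.Cruxes.H413.K2E1SpectralTermsDiscreteHalf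
open Summit.HodgeConjecture.HodgeConjecture.Cruxes.H413.K2E1EvpOfAutomorphicClass
open Summit.HodgeConjecture.HodgeConjecture.Cruxes.H413.F0P3ClassTokenChoice

namespace Summit.HodgeConjecture.HodgeConjecture.R90.S10

section Frozen

variable (L : Type) [Field L] [NumberField L] [IsCMField L] [DecidableEq (Pl L)] (μ : HeckeCharacter L) (v : Pl L)
  [MeasurableSpace (HLoc L v)] [BorelSpace (HLoc L v)] [MeasurableSpace (Gqs L v)] [BorelSpace (Gqs L v)]
  (νHv : Measure (HLoc L v)) (νQv : Measure (Gqs L v)) [νHv.IsHaarMeasure] [νHv.IsMulRightInvariant] [νQv.IsHaarMeasure] [νQv.IsMulRightInvariant]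
  [∀ a : HLoc L v, MeasurableSpace (HLoc L v ⧸ Subgroup.centralizer ({a} : Set (HLoc L v)))]
  [∀ a : HLoc L v, BorelSpace (HLoc L v ⧸ Subgroup.centralizer ({a} : Set (HLoc L v)))]
  [∀ γ : Gqs L v, MeasurableSpace (Gqs L v ⧸ Subgroup.centralizer ({γ} : Set (Gqs L v)))]
  [∀ γ : Gqs L v, BorelSpace (Gqs L v ⧸ Subgroup.centralizer ({γ} : Set (Gqs L v)))]
  (mHv : OrbitalMeasureFamily (HLoc L v)) (mQv : OrbitalMeasureFamily (Gqs L v)) (πSt : IrrClass (HLoc L v))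
  [MeasurableSpace (G3 L).Adelic] [BorelSpace (G3 L).Adelic] [MeasurableSpace (H2 L).Adelic] [BorelSpace (H2 L).Adelic]
  [MeasurableSpace (GArch L)] [BorelSpace (GArch L)] [MeasurableSpace (HArch L)] [BorelSpace (HArch L)]
  [MeasurableSpace (H1Loc L v)] [MeasurableSpace (H1Arch L)] [MeasurableSpace (H1 L).Adelic] [BorelSpace (H1 L).Adelic]

/-- **(P-t₀) PAID MODULO SPHERICAL BASE CHANGE, `hadm`-FORM — «every member of the cut of record has e.v.p. `t₀`» at a level `S ∋ v`.**  As ★ `germOfMembersLetter_of_bcSpherical`,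
with the by-value spherical base change `hbc` asked only of ADMISSIBLE classes: `hbc : ∀ w ≠ v, w ∉ S, ∀ πw, πw.IsAdmissible → ∀ hsph, LiesOver … πw (𝔥.ρ w) → unopClassSphericalCharacter
… πw hsph = t₀.1 ⟨w, _⟩` (RULING (R15): the form the ★ rigidity payers supply).  PROOF: ★ p864664's, the member's local class `loc i w` being admissible by ★ `isAdmissible_of_isLinked`
(it is LINKED to the discrete class `cl i`, ★ `S10GCutCore.memG`). [cite: Rogawski1990, §13.6 p. 209; §13.8 display (13.8.3) p. 218 L5–7, p. 219 L3; §4.9 Prop. 4.9.1 (b) p. 55]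
[cite: FlathCorvallis1979, Thm. 3] [cite: BorelJacquet1979, §4.6] [cite: CartierCorvallis1979, §IV.1 Cor. 4.1] -/
theorem germOfMembersLetter_of_bcSpherical_adm (𝔣' : S10FrozenDatum L μ v νHv νQv mHv mQv πSt) (S : Set (Pl L)) (hv : v ∈ S)
    {P : Ch13Sec6.EigenvaluePackage S (fun w => heckeAlgebra ℂ (Gqs L w) (cmLocalIntegralLevel L 3 (qsForm L) w)) → Prop}
    (hRepGerm : haveI := 𝔣'.𝔤.hμG; ∀ c : DiscreteClass (G3 L) 𝔣'.𝔤.μG, P (germOfDiscreteClass S c))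
    (t₀ : {t : Ch13Sec6.EigenvaluePackage S (fun w => heckeAlgebra ℂ (Gqs L w) (cmLocalIntegralLevel L 3 (qsForm L) w)) // P t})
    (hbc : ∀ (w : {w : Pl L // w ≠ v}) (hwS : w.1 ∉ S) (πw : IrrClass (Gqs L w.1)) (hadm : πw.IsAdmissible)
      (hsph : πw.IsSpherical (cmLocalIntegralLevel L 3 (qsForm L) w.1)),
      LiesOver L μ w.1 (𝔣'.𝔳.K w.1) (𝔣'.𝔥.KH w.1) (𝔣'.𝔳.νQ w) (𝔣'.𝔳.νHw w) (𝔣'.𝔳.mH w) (𝔣'.𝔳.mQ w) πw (𝔣'.𝔥.ρ w.1) →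
      unopClassSphericalCharacter (cmLocalIntegralLevel L 3 (qsForm L) w.1) πw hsph = t₀.1 ⟨w.1, hwS⟩) :
    haveI := 𝔣'.𝔤.hμG
    GermOfMembersLetter 𝔣' (fun c => (⟨germOfDiscreteClass S c, hRepGerm c⟩ :
      {t : Ch13Sec6.EigenvaluePackage S (fun w => heckeAlgebra ℂ (Gqs L w) (cmLocalIntegralLevel L 3 (qsForm L) w)) // P t})) t₀ := by
  haveI := 𝔣'.𝔤.hμG
  intro i
  apply Subtype.ext
  -- off `S ∋ v` every place is `≠ v`; the member's local classes are spherical at `U(Φ₃)(𝒪_w) = 𝔳.K w` there (`LiesOver`'s first clause) and ADMISSIBLE (linked to `cl i`)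
  have hne : ∀ w : Pl L, w ∉ S → w ≠ v := fun w hw h => hw (h ▸ hv)
  have hsph : ∀ w : Pl L, w ∉ S → (𝔣'.𝔤.loc i w).IsSpherical (cmLocalIntegralLevel L 3 (qsForm L) w) := fun w hw => by
    rw [← 𝔣'.𝔳.hKstd w (hne w hw)]
    exact ((𝔣'.𝔤.memG i).2 ⟨w, hne w hw⟩).1
  have hadm : ∀ w : Pl L, (𝔣'.𝔤.loc i w).IsAdmissible := fun w => isAdmissible_of_isLinked L (qsForm L) (𝔣'.𝔤.cl i) (𝔣'.𝔤.memG i).1 w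
  show germOfDiscreteClass S (𝔣'.𝔤.cl i) = t₀.1
  -- (J2): the germ of the linked member is the E1 package of its local classes
  rw [germOfDiscreteClass_eq_evpAtIntegralLevel_of_isLinked L (qsForm L) S (𝔣'.𝔤.cl i) (𝔣'.𝔤.memG i).1 hsph]
  funext w
  -- spherical base change at `w`, fed by the member's admissibility and `LiesOver`
  exact hbc ⟨w.1, hne w.1 w.2⟩ w.2 (𝔣'.𝔤.loc i w.1) (hadm w.1) (hsph w.1 w.2) ((𝔣'.𝔤.memG i).2 ⟨w.1, hne w.1 w.2⟩)

/-- **(P-t₀), `hadm`-FORM, AT THE LEVEL OF RECORD `S := {v}` (regime ⟪U⟫)** — the one-line instance of `germOfMembersLetter_of_bcSpherical_adm`.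
[cite: Rogawski1990, §13.8 p. 219 L3; §13.6 p. 209] -/
theorem germOfMembersLetter_of_bcSpherical_singleton_adm (𝔣' : S10FrozenDatum L μ v νHv νQv mHv mQv πSt)
    {P : Ch13Sec6.EigenvaluePackage ({v} : Set (Pl L)) (fun w => heckeAlgebra ℂ (Gqs L w) (cmLocalIntegralLevel L 3 (qsForm L) w)) → Prop}
    (hRepGerm : haveI := 𝔣'.𝔤.hμG; ∀ c : DiscreteClass (G3 L) 𝔣'.𝔤.μG, P (germOfDiscreteClass {v} c))
    (t₀ : {t : Ch13Sec6.EigenvaluePackage ({v} : Set (Pl L)) (fun w => heckeAlgebra ℂ (Gqs L w) (cmLocalIntegralLevel L 3 (qsForm L) w)) // P t})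
    (hbc : ∀ (w : {w : Pl L // w ≠ v}) (hwS : w.1 ∉ ({v} : Set (Pl L))) (πw : IrrClass (Gqs L w.1)) (hadm : πw.IsAdmissible)
      (hsph : πw.IsSpherical (cmLocalIntegralLevel L 3 (qsForm L) w.1)),
      LiesOver L μ w.1 (𝔣'.𝔳.K w.1) (𝔣'.𝔥.KH w.1) (𝔣'.𝔳.νQ w) (𝔣'.𝔳.νHw w) (𝔣'.𝔳.mH w) (𝔣'.𝔳.mQ w) πw (𝔣'.𝔥.ρ w.1) →
      unopClassSphericalCharacter (cmLocalIntegralLevel L 3 (qsForm L) w.1) πw hsph = t₀.1 ⟨w.1, hwS⟩) :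
    haveI := 𝔣'.𝔤.hμG
    GermOfMembersLetter 𝔣' (fun c => (⟨germOfDiscreteClass {v} c, hRepGerm c⟩ :
      {t : Ch13Sec6.EigenvaluePackage ({v} : Set (Pl L)) (fun w => heckeAlgebra ℂ (Gqs L w) (cmLocalIntegralLevel L 3 (qsForm L) w)) // P t})) t₀ :=
  germOfMembersLetter_of_bcSpherical_adm L μ v νHv νQv mHv mQv πSt 𝔣' {v} (Set.mem_singleton v) hRepGerm t₀ hbc

/-- **(P-t₀), `hadm`-FORM, IN THE PLAIN GERM CURRENCY `evp := germOfDiscreteClass S`** (p07 (g2)'s keystone binder `ht₀ : GermOfMembersLetter 𝔣 (germOfDiscreteClass S) t₀`, no pin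
subtype): same hypotheses minus `P ∕ hRepGerm`, `t₀` a bare package off `S`; same proof without `Subtype.ext`.
[cite: Rogawski1990, §13.6 p. 209; §13.8 p. 219 L3; §4.9 Prop. 4.9.1 (b) p. 55] [cite: FlathCorvallis1979, Thm. 3] [cite: BorelJacquet1979, §4.6] -/
theorem germOfMembersLetter_of_bcSpherical_plain_adm (𝔣' : S10FrozenDatum L μ v νHv νQv mHv mQv πSt) (S : Set (Pl L)) (hv : v ∈ S)
    (t₀ : Ch13Sec6.EigenvaluePackage S (fun w => heckeAlgebra ℂ (Gqs L w) (cmLocalIntegralLevel L 3 (qsForm L) w)))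
    (hbc : ∀ (w : {w : Pl L // w ≠ v}) (hwS : w.1 ∉ S) (πw : IrrClass (Gqs L w.1)) (hadm : πw.IsAdmissible)
      (hsph : πw.IsSpherical (cmLocalIntegralLevel L 3 (qsForm L) w.1)),
      LiesOver L μ w.1 (𝔣'.𝔳.K w.1) (𝔣'.𝔥.KH w.1) (𝔣'.𝔳.νQ w) (𝔣'.𝔳.νHw w) (𝔣'.𝔳.mH w) (𝔣'.𝔳.mQ w) πw (𝔣'.𝔥.ρ w.1) →
      unopClassSphericalCharacter (cmLocalIntegralLevel L 3 (qsForm L) w.1) πw hsph = t₀ ⟨w.1, hwS⟩) :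
    haveI := 𝔣'.𝔤.hμG
    GermOfMembersLetter 𝔣' (germOfDiscreteClass S) t₀ := by
  haveI := 𝔣'.𝔤.hμG
  intro i
  have hne : ∀ w : Pl L, w ∉ S → w ≠ v := fun w hw h => hw (h ▸ hv)
  have hsph : ∀ w : Pl L, w ∉ S → (𝔣'.𝔤.loc i w).IsSpherical (cmLocalIntegralLevel L 3 (qsForm L) w) := fun w hw => by
    rw [← 𝔣'.𝔳.hKstd w (hne w hw)]
    exact ((𝔣'.𝔤.memG i).2 ⟨w, hne w hw⟩).1
  have hadm : ∀ w : Pl L, (𝔣'.𝔤.loc i w).IsAdmissible := fun w => isAdmissible_of_isLinked L (qsForm L) (𝔣'.𝔤.cl i) (𝔣'.𝔤.memG i).1 w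
  show germOfDiscreteClass S (𝔣'.𝔤.cl i) = t₀
  rw [germOfDiscreteClass_eq_evpAtIntegralLevel_of_isLinked L (qsForm L) S (𝔣'.𝔤.cl i) (𝔣'.𝔤.memG i).1 hsph]
  funext w
  exact hbc ⟨w.1, hne w.1 w.2⟩ w.2 (𝔣'.𝔤.loc i w.1) (hadm w.1) (hsph w.1 w.2) ((𝔣'.𝔤.memG i).2 ⟨w.1, hne w.1 w.2⟩)

end Frozen

end Summit.HodgeConjecture.HodgeConjecture.R90.S10

end
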